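import Summits.HodgeConjecture.HodgeConjecture.Theorems.Ring2WeilCoverageCMFieldNormDescent
import HarnessLib

/-!
# Further decided non-split Weil-type components over quartic CM fields: `ℓ = 5` for
# `E = ℚ(√-(2+√2))` and `ℓ = 7` for `E = ℚ(ζ₅)`

research route conditional on HC_CM; not a corollary; Q11.4-sentence-2 already refuted in dim ≥ 3.
Cell `pub-hodge-ring2`, seat `ring2-b03` (gen 46); instances of the generic ℓ-adic criterion
`Ring2.WeilCoverageCM.mk_prime_mul_ne_splitDiscriminantClassCM` (`Theorems/Ring2WeilCoverageCMFieldNormDescent.lean`)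
for the Weil-type family-coverage census `HOME/WEIL-FAMILY-COVERAGE.md` §b03.5:

* `E = ℚ(√-(2+√2))` (`R = S² + 4S + 2`, `F = ℚ(√2)`), `ℓ = 5` (inert in `F` and in `E/F`; a 625-case
  `decide` over `𝔽₂₅`): `[5w] ≠ [1]` for `5 ∤ w` — rows `W8.E.{(√2),(5)}` (`δ = [5]`), `[10]`, `[15]`, `[20]`, `[35]`, … .
* `E = ℚ(ζ₅)` (`R = S² + 5S + 5`, `F = ℚ(√5)`), `ℓ = 7` (inert in `F`, norm 49, and in `E/F`; a 2401-case
  `decide` over `𝔽₄₉`): `[7w] ≠ [1]` for `7 ∤ w` — rows `W8.ℚ(ζ₅).{(√5),(7)}` (`δ = [7]`), `[14]`, `[21]`, `[28]`, `[35]`, … .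

Together with `zeta5_mk_three_mul_ne_splitDiscriminantClassCM` (`ℓ = 3`) and
`sqrtNegTwoPlusSqrtTwo_mk_three_mul_ne_splitDiscriminantClassCM` these decide, for the two cyclic quartic CM
fields of the census, every class `[n]` with `v₃(n) = 1` or `v₇(n) = 1` (`ℚ(ζ₅)`), resp. `v₃(n) = 1` or
`v₅(n) = 1` (`ℚ(√-(2+√2))`), as NON-SPLIT (Deligne Cor. 4.2: no `E`-Lagrangian member).
No named fact, no definition, no `sorry`; nothing about the Hodge conjecture is asserted.
References: [Deligne1982HodgeCycles] §4 p. 30 (1), Cor. 4.2; [Landherr1936HermitianForms]. -/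

noncomputable section

set_option linter.dupNamespace false

open Polynomial

namespace Summit.HodgeConjecture.HodgeConjecture.Ring2.WeilCoverageCM

open Literature.AlgebraicGeometry.Deligne1982
open Literature.AlgebraicGeometry.HodgeTheory (splitDiscriminantClassCM)

/-! ### `E = ℚ(√-(2+√2))`, `ℓ = 5` -/

/-- **Anisotropy mod 5 for `(p, q) = (4, 2)`** (`5` is inert in `ℚ(√2)` and in `ℚ(√-(2+√2))/ℚ(√2)`):
625 cases. [folklore] -/
theorem aniso_five_sqrtNegTwoPlusSqrtTwo :
    ∀ a b c d : ZMod 5,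
      a ^ 2 - ((2 : ℤ) : ZMod 5) * b ^ 2 + 2 * ((2 : ℤ) : ZMod 5) * c * d
          - ((4 : ℤ) : ZMod 5) * ((2 : ℤ) : ZMod 5) * d ^ 2 = 0 →
      2 * a * b - ((4 : ℤ) : ZMod 5) * b ^ 2 - c ^ 2 + 2 * ((4 : ℤ) : ZMod 5) * c * d
          - (((4 : ℤ) : ZMod 5) ^ 2 - ((2 : ℤ) : ZMod 5)) * d ^ 2 = 0 →
        a = 0 ∧ b = 0 ∧ c = 0 ∧ d = 0 := by
  decide

/-- **`[5w] ≠ [1]` in `F^×/Nm_{E/F}(E^×)` for `E = ℚ(√-(2+√2))`, `F = ℚ(√2)`, `5 ∤ w`**: the Weil-type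
components `(E, 4, [5])`, `[10]`, `[15]`, … of the census are NON-SPLIT.
[cite: Deligne1982HodgeCycles, §4 p. 30 (1) and Cor. 4.2] [cite: Landherr1936HermitianForms] -/
theorem sqrtNegTwoPlusSqrtTwo_mk_five_mul_ne_splitDiscriminantClassCM {R : Polynomial ℤ}
    (hR : R = X ^ 2 + C 4 * X + C 2) [Fact (Irreducible (realPolyQ R))] (w : ℤ) (hw : ¬ (5 : ℤ) ∣ w)
    (u : (realField R)ˣ) (hu : (u : realField R) = AdjoinRoot.of (realPolyQ R) (5 * w)) :
    (QuotientGroup.mk u : cmNormResidueGroup R) ≠ splitDiscriminantClassCM R 2 := by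
  haveI : Fact (Irreducible (cmPolyQ R)) := fact_irreducible_cmPolyQ_sqrtNegTwoPlusSqrtTwo hR
  haveI : Fact (Nat.Prime 5) := ⟨Nat.prime_five⟩
  exact mk_prime_mul_ne_splitDiscriminantClassCM hR 5 aniso_five_sqrtNegTwoPlusSqrtTwo w hw u
    (by rw [hu]; push_cast; ring_nf)

/-- **`[5] ≠ [1]`** for `E = ℚ(√-(2+√2))`: the row `W8.E.{(√2),(5)}` (least representative `δ = 5`) of the
census is a non-split component. [cite: Deligne1982HodgeCycles, §4 p. 30 (1) and Cor. 4.2] -/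
theorem sqrtNegTwoPlusSqrtTwo_mk_five_ne_splitDiscriminantClassCM {R : Polynomial ℤ}
    (hR : R = X ^ 2 + C 4 * X + C 2) [Fact (Irreducible (realPolyQ R))]
    (u : (realField R)ˣ) (hu : (u : realField R) = 5) :
    (QuotientGroup.mk u : cmNormResidueGroup R) ≠ splitDiscriminantClassCM R 2 :=
  sqrtNegTwoPlusSqrtTwo_mk_five_mul_ne_splitDiscriminantClassCM hR 1 (by norm_num) u (by rw [hu]; simp)

/-! ### `E = ℚ(ζ₅)`, `ℓ = 7` -/

/-- **Anisotropy mod 7 for `(p, q) = (5, 5)`** (`7` is inert in `ℚ(√5)` and `(7)` is inert in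
`ℚ(ζ₅)/ℚ(√5)`): 2401 cases. [folklore] -/
theorem aniso_seven_zeta5 :
    ∀ a b c d : ZMod 7,
      a ^ 2 - ((5 : ℤ) : ZMod 7) * b ^ 2 + 2 * ((5 : ℤ) : ZMod 7) * c * d
          - ((5 : ℤ) : ZMod 7) * ((5 : ℤ) : ZMod 7) * d ^ 2 = 0 →
      2 * a * b - ((5 : ℤ) : ZMod 7) * b ^ 2 - c ^ 2 + 2 * ((5 : ℤ) : ZMod 7) * c * d
          - (((5 : ℤ) : ZMod 7) ^ 2 - ((5 : ℤ) : ZMod 7)) * d ^ 2 = 0 →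
        a = 0 ∧ b = 0 ∧ c = 0 ∧ d = 0 := by
  decide

/-- **`[7w] ≠ [1]` in `F^×/Nm_{E/F}(E^×)` for `E = ℚ(ζ₅)`, `F = ℚ(√5)`, `7 ∤ w`**: the Weil-type components
`(ℚ(ζ₅), 4, [7])`, `[14]`, `[21]`, `[28]`, … of the census are NON-SPLIT.
[cite: Deligne1982HodgeCycles, §4 p. 30 (1) and Cor. 4.2] [cite: Landherr1936HermitianForms] -/
theorem zeta5_mk_seven_mul_ne_splitDiscriminantClassCM {R : Polynomial ℤ}
    (hR : R = X ^ 2 + C 5 * X + C 5) [Fact (Irreducible (realPolyQ R))] (w : ℤ) (hw : ¬ (7 : ℤ) ∣ w)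
    (u : (realField R)ˣ) (hu : (u : realField R) = AdjoinRoot.of (realPolyQ R) (7 * w)) :
    (QuotientGroup.mk u : cmNormResidueGroup R) ≠ splitDiscriminantClassCM R 2 := by
  haveI : Fact (Irreducible (cmPolyQ R)) := fact_irreducible_cmPolyQ_R5 hR
  haveI : Fact (Nat.Prime 7) := ⟨by norm_num⟩
  exact mk_prime_mul_ne_splitDiscriminantClassCM hR 7 aniso_seven_zeta5 w hw u
    (by rw [hu]; push_cast; ring_nf)

/-- **`[7] ≠ [1]`** for `E = ℚ(ζ₅)`: the component with `δ = [7]` (`T = {(√5), (7)}`) is non-split.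
[cite: Deligne1982HodgeCycles, §4 p. 30 (1) and Cor. 4.2] -/
theorem zeta5_mk_seven_ne_splitDiscriminantClassCM {R : Polynomial ℤ}
    (hR : R = X ^ 2 + C 5 * X + C 5) [Fact (Irreducible (realPolyQ R))]
    (u : (realField R)ˣ) (hu : (u : realField R) = 7) :
    (QuotientGroup.mk u : cmNormResidueGroup R) ≠ splitDiscriminantClassCM R 2 :=
  zeta5_mk_seven_mul_ne_splitDiscriminantClassCM hR 1 (by norm_num) u (by rw [hu]; simp)

end Summit.HodgeConjecture.HodgeConjecture.Ring2.WeilCoverageCM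

end
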